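import Summits.BirchSwinnertonDyer.Rank1Residual.X2.IsogenySelmerInfty
import Literature.NumberTheory.EllipticCurves.IwasawaSelmer
import Mathlib.RingTheory.TensorProduct.Basic
import HarnessLib

/-!
# The `λ`-invariant of `X(E/K_∞) = Sel_{p^∞}(E/K_∞)^∨` is a `K`-isogeny invariant
# (cell `b2b-bsdres`, unit `b2b-bsdres-eisenstein-p2`, gen 18)

HONEST FRAMING (run/shared/lean/b2b/bsd-rank1-residual/, verbatim in every file): the goal of the
cell is to DELETE the COMBINATION-SHAPED residual classes of the Birch–Swinnerton-Dyer formula for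
ALL analytic-rank `≤ 1` elliptic curves over `ℚ` — "full BSD formula for every rank `≤ 1` curve in
class `C`" assembled STRICTLY from published theorems — so that the rank-`≤ 1` remainder becomes
exactly the CONSTRUCTION-SHAPED classes, which are TYPED (missing-input `Prop`s), NOT attempted.
This is not "finishing BSD". Research route; NO CLAIM BEYOND STATED CLASSES; nothing here changes
a label. Definitions with bodies (`baseChangeEquivOfQuasiInverse`, `toDualEquiv`, `dualMap`) and
theorems; no named fact.

WHAT (GV 2000 p. 28: "The `λ`-invariant is always unchanged by an isogeny" — the algebraic input of
GV's reduction of CASE 2 of their Thm. (1.3) to CASE 1, X2-GAP §22.6 (iii)), as a KERNEL theorem in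
the tree's vocabulary (`WeierstrassCurve.SelmerDualData`, `lambdaInvariant`):

* §1 `baseChangeEquivOfQuasiInverse` / `finrank_baseChange_eq_of_quasiInverse` — `R`-linear
  `F : Y → X`, `G : X → Y` with `F ∘ G = n`, `G ∘ F = n`, `n` invertible in a field `A ⊇ R`, give
  `A ⊗_R Y ≃ A ⊗_R X` (inverse `n⁻¹ · (G ⊗ 1)`), hence equal `A`-dimensions;
* §2 `dualMap D D' α : X(E'/K_∞) → X(E/K_∞)` — the Pontryagin dual (precomposition of characters
  through `toDual`) of an additive `α : Sel_{p^∞}(E/K_∞) → Sel_{p^∞}(E'/K_∞)`; `ℤ_p`-LINEAR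
  (`dualMap_C_smul`: constants act through `ℤ_p → ℤ/p^k` on `p^k`-torsion classes on both sides,
  `toDual_C_smul` + `exists_pow_smul_subgroupH1_ker_eq_zero`); `β ∘ α = n ⟹ α^∨ ∘ β^∨ = n`;
* §3 **`lambdaInvariant_eq_of_isogeny`**: for a `K`-isogeny `φ : E → E'` of elliptic curves over a
  number field, ANY `ℤ_p`-extension `κ`, any `γ`, and any dual data `D`, `D'`:
  `λ(D.X) = λ(D'.X)` — with `Sel(φ)`, `Sel(φ̂)` of `X2/IsogenySelmerInfty` (`φ̂ ∘ φ = [deg φ]`,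
  `φ ∘ φ̂ = [deg φ]`, Silverman III.6.1–6.2) dualised to `ℤ_p`-linear quasi-inverse maps, and the
  tree's DEFINITION `lambdaInvariant p X = dim_{ℚ_p}(ℚ_p ⊗_{ℤ_p} X)`. No cotorsion, `μ` or
  finiteness hypothesis is needed (`μ` CAN change under a `p`-isogeny — Schneider; not touched).

References: [GreenbergVatsal2000] §2 p. 28; [SilvermanAEC2009] III.6.1–6.2; [GreenbergLNM1716] §1;
[Washington1997] §13.2 (`λ = rank_{ℤ_p}`); HOME/b2b-bsdres-eisenstein-p2/X2-GAP.md §23.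
-/

set_option autoImplicit false

noncomputable section

open scoped Classical TensorProduct

universe u

open WeierstrassCurve Literature.NumberTheory.EllipticCurves Field IsDedekindDomain NumberField
  Summit.BirchSwinnertonDyer.Rank1Residual.X2.IsogenySelmerInfty

namespace Summit.BirchSwinnertonDyer.Rank1Residual.X2.IsogenyLambdaInvariant

/-! ## §1. Linear algebra: quasi-inverse maps give isomorphic `ℚ_p`-spans -/

section Algebra

variable {R : Type*} [CommRing R] (A : Type*) [Field A] [Algebra R A]
  {X Y : Type*} [AddCommGroup X] [Module R X] [AddCommGroup Y] [Module R Y]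

/-- **Two `R`-modules linked by maps `F : Y → X`, `G : X → Y` with `F ∘ G = n`, `G ∘ F = n` for a
scalar `n ∈ R` invertible in the field `A ⊇ R` have isomorphic base changes `A ⊗_R X ≃ A ⊗_R Y`**
(`F ⊗ 1` and `n⁻¹ · (G ⊗ 1)` are inverse). The linear algebra behind "the `λ`-invariant is unchanged
by an isogeny" (GV 2000 p. 28). [folklore] -/
def baseChangeEquivOfQuasiInverse (F : Y →ₗ[R] X) (G : X →ₗ[R] Y) (n : R)
    (hn : IsUnit (algebraMap R A n)) (hFG : F.comp G = n • LinearMap.id)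
    (hGF : G.comp F = n • LinearMap.id) : A ⊗[R] Y ≃ₗ[A] A ⊗[R] X :=
  LinearEquiv.ofLinear (F.baseChange A) (hn.unit⁻¹.val • G.baseChange A)
    (by
      rw [LinearMap.comp_smul, ← LinearMap.baseChange_comp, hFG, LinearMap.baseChange_smul,
        LinearMap.baseChange_id]
      refine LinearMap.ext fun x ↦ ?_
      rw [LinearMap.smul_apply, LinearMap.smul_apply, LinearMap.id_apply, ← algebraMap_smul A n x,
        smul_smul, IsUnit.val_inv_mul, one_smul])
    (by
      rw [LinearMap.smul_comp, ← LinearMap.baseChange_comp, hGF, LinearMap.baseChange_smul,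
        LinearMap.baseChange_id]
      refine LinearMap.ext fun y ↦ ?_
      rw [LinearMap.smul_apply, LinearMap.smul_apply, LinearMap.id_apply, ← algebraMap_smul A n y,
        smul_smul, IsUnit.val_inv_mul, one_smul])

/-- Hence equal `A`-dimensions of the base changes. [folklore] -/
theorem finrank_baseChange_eq_of_quasiInverse (F : Y →ₗ[R] X) (G : X →ₗ[R] Y) (n : R)
    (hn : IsUnit (algebraMap R A n)) (hFG : F.comp G = n • LinearMap.id)
    (hGF : G.comp F = n • LinearMap.id) :
    Module.finrank A (A ⊗[R] X) = Module.finrank A (A ⊗[R] Y) :=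
  (baseChangeEquivOfQuasiInverse A F G n hn hFG hGF).finrank_eq.symm

end Algebra

/-! ## §2. The dual of a map of Selmer groups on the Iwasawa modules -/

section Dual

variable {K : Type u} [Field K] [NumberField K] {W W' : WeierstrassCurve K} {p : ℕ} [Fact p.Prime]
  {κ : ZpExtension K p} {γ : absoluteGaloisGroup K}
  (D : W.SelmerDualData κ γ) (D' : W'.SelmerDualData κ γ)

/-- The group isomorphism `X ≃ Hom(Sel_∞, ℚ/ℤ)` of a dual datum. [folklore] -/
def toDualEquiv : D.X ≃+ (W.selmerInfty κ →+ AddCircle (1 : ℚ)) :=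
  AddEquiv.ofBijective D.toDual D.bijective

/-- **The dual `α^∨ : X(E'/K_∞) → X(E/K_∞)` of an additive map `α : Sel_{p^∞}(E/K_∞) → Sel_{p^∞}(E'/K_∞)`**
(precomposition of characters, transported through `toDual`). [folklore] -/
def dualMap (α : W.selmerInfty κ →+ W'.selmerInfty κ) : D'.X →+ D.X where
  toFun x' := (toDualEquiv D).symm ((D'.toDual x').comp α)
  map_zero' := by
    rw [map_zero, AddMonoidHom.zero_comp, map_zero]
  map_add' x y := by
    rw [← map_add, map_add, AddMonoidHom.add_comp]

/-- Defining identity of `dualMap`: `toDual (α^∨ x') = toDual' x' ∘ α`. [folklore] -/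
theorem toDual_dualMap (α : W.selmerInfty κ →+ W'.selmerInfty κ) (x' : D'.X) :
    D.toDual (dualMap D D' α x') = (D'.toDual x').comp α := by
  change (toDualEquiv D) ((toDualEquiv D).symm _) = _
  rw [AddEquiv.apply_symm_apply]

/-- **`α^∨` is `ℤ_p`-linear** for the `ℤ_p`-structures of the two Iwasawa modules (restriction of
scalars along `ℤ_p → Λ`): constants act on a `p^k`-torsion class through `ℤ_p → ℤ/p^k` on both sides
(`toDual_C_smul`), and every class of `Sel_{p^∞}(E/K_∞)` is `p^k`-torsion for some `k`
(`exists_pow_smul_subgroupH1_ker_eq_zero`). [folklore] -/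
theorem dualMap_C_smul (α : W.selmerInfty κ →+ W'.selmerInfty κ) (c : ℤ_[p]) (x' : D'.X) :
    dualMap D D' α (PowerSeries.C c • x') = PowerSeries.C c • dualMap D D' α x' := by
  apply D.bijective.1
  rw [toDual_dualMap]
  ext s
  obtain ⟨k, hk⟩ := W.exists_pow_smul_subgroupH1_ker_eq_zero κ (s : W.subgroupH1 p κ.kerSubgroup)
  have hks : (p ^ k) • s = 0 := Subtype.ext (by
    rw [AddSubmonoidClass.coe_nsmul]; exact hk)
  have hkα : (p ^ k) • α s = 0 := by rw [← map_nsmul, hks, map_zero]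
  rw [AddMonoidHom.comp_apply, D'.toDual_C_smul c x' (α s) k hkα,
    D.toDual_C_smul c (dualMap D D' α x') s k hks, toDual_dualMap, AddMonoidHom.comp_apply]

/-- **`(β ∘ α)^∨ = α^∨ ∘ β^∨`-type computation: if `β ∘ α = n` on `Sel_{p^∞}(E/K_∞)` then
`α^∨ ∘ β^∨ = n` on `X(E/K_∞)`.** [folklore] -/
theorem dualMap_dualMap_of_comp_eq_nsmul
    (α : W.selmerInfty κ →+ W'.selmerInfty κ) (β : W'.selmerInfty κ →+ W.selmerInfty κ) {n : ℕ}
    (h : ∀ s, β (α s) = n • s) (x : D.X) :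
    dualMap D D' α (dualMap D' D β x) = n • x := by
  apply D.bijective.1
  rw [toDual_dualMap, map_nsmul]
  ext s
  rw [AddMonoidHom.comp_apply, toDual_dualMap, AddMonoidHom.comp_apply, h, map_nsmul,
    AddMonoidHom.nsmul_apply]

end Dual

/-! ## §3. `λ(E/K_∞) = λ(E'/K_∞)` for `K`-isogenous elliptic curves -/

section Isogeny

variable {K : Type u} [Field K] [NumberField K] {W W' : WeierstrassCurve K} [W.IsElliptic]
  [W'.IsElliptic] {p : ℕ} [Fact p.Prime] {κ : ZpExtension K p} {γ : absoluteGaloisGroup K}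

/-- **The `λ`-invariant of the Iwasawa module `X(E/K_∞) = Sel_{p^∞}(E/K_∞)^∨` is a `K`-isogeny
invariant** ("The `λ`-invariant is always unchanged by an isogeny", Greenberg–Vatsal 2000, p. 28):
for a `K`-isogeny `φ : E → E'` of elliptic curves over a number field, any `ℤ_p`-extension `κ`,
any `γ`, and any Pontryagin-dual data `D`, `D'` of the two Selmer groups over `K_∞`,
`λ(D.X) = λ(D'.X)`. Proof: `Sel(φ)`, `Sel(φ̂)` (`X2/IsogenySelmerInfty`, dual isogeny
`φ̂ ∘ φ = [deg φ]`, `φ ∘ φ̂ = [deg φ]`) dualise to `ℤ_p`-linear maps `X' ⇄ X` with both composites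
`deg φ`, so `ℚ_p ⊗ X ≅ ℚ_p ⊗ X'` and the tree's `lambdaInvariant = dim_{ℚ_p}(ℚ_p ⊗_{ℤ_p} X)` agree.
No torsion / finiteness hypothesis is needed. [cite: GreenbergVatsal2000, §2 p. 28 ("The λ-invariant is always unchanged by an isogeny")] -/
theorem lambdaInvariant_eq_of_isogeny (φ : Isogeny W W') (D : W.SelmerDualData κ γ)
    (D' : W'.SelmerDualData κ γ) : lambdaInvariant p D.X = lambdaInvariant p D'.X := by
  obtain ⟨ψ, hψ⟩ := φ.exists_dual_of_isElliptic
  set n : ℕ := φ.degree with hn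
  have hn0 : n ≠ 0 := φ.degree_pos.ne'
  -- `φ ∘ ψ = [n]` as well (`φ` is onto)
  have hφψ : ∀ Q : W'.geomPoints, φ (ψ Q) = (n : ℤ) • Q := by
    intro Q
    obtain ⟨P, rfl⟩ := φ.surjective Q
    rw [hψ, map_zsmul]
  -- the Selmer maps and their composites
  set α := isogenySelmerInftyMap p κ φ with hα
  set β := isogenySelmerInftyMap p κ ψ with hβ
  have hβα : ∀ s, β (α s) = n • s := fun s ↦ isogenySelmerInftyMap_comp_apply p κ φ ψ hψ s
  have hαβ : ∀ s, α (β s) = n • s := fun s ↦ isogenySelmerInftyMap_comp_apply p κ ψ φ hφψ s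
  -- the `ℤ_p`-structures by restriction of scalars along `ℤ_p → Λ` (as in `lambdaInvariant`)
  letI iX : Module ℤ_[p] D.X := Module.compHom D.X (algebraMap ℤ_[p] (IwasawaAlgebra p))
  letI iX' : Module ℤ_[p] D'.X := Module.compHom D'.X (algebraMap ℤ_[p] (IwasawaAlgebra p))
  -- the dual `ℤ_p`-linear maps `F = α^∨ : X' → X`, `G = β^∨ : X → X'`
  let F : D'.X →ₗ[ℤ_[p]] D.X :=
    { toFun := dualMap D D' α
      map_add' := (dualMap D D' α).map_add
      map_smul' := fun c x' ↦ by
        change dualMap D D' α (algebraMap ℤ_[p] (IwasawaAlgebra p) c • x') =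
          algebraMap ℤ_[p] (IwasawaAlgebra p) c • dualMap D D' α x'
        rw [← PowerSeries.C_eq_algebraMap]
        exact dualMap_C_smul D D' α c x' }
  let G : D.X →ₗ[ℤ_[p]] D'.X :=
    { toFun := dualMap D' D β
      map_add' := (dualMap D' D β).map_add
      map_smul' := fun c x ↦ by
        change dualMap D' D β (algebraMap ℤ_[p] (IwasawaAlgebra p) c • x) =
          algebraMap ℤ_[p] (IwasawaAlgebra p) c • dualMap D' D β x
        rw [← PowerSeries.C_eq_algebraMap]
        exact dualMap_C_smul D' D β c x }
  have hFG : F.comp G = (n : ℤ_[p]) • LinearMap.id := by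
    ext x
    change dualMap D D' α (dualMap D' D β x) = algebraMap ℤ_[p] (IwasawaAlgebra p) (n : ℤ_[p]) • x
    rw [dualMap_dualMap_of_comp_eq_nsmul D D' α β hβα x, map_natCast, Nat.cast_smul_eq_nsmul]
  have hGF : G.comp F = (n : ℤ_[p]) • LinearMap.id := by
    ext x'
    change dualMap D' D β (dualMap D D' α x') = algebraMap ℤ_[p] (IwasawaAlgebra p) (n : ℤ_[p]) • x'
    rw [dualMap_dualMap_of_comp_eq_nsmul D' D β α hαβ x', map_natCast, Nat.cast_smul_eq_nsmul]
  have hunit : IsUnit (algebraMap ℤ_[p] ℚ_[p] (n : ℤ_[p])) := by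
    rw [map_natCast, isUnit_iff_ne_zero]
    exact_mod_cast hn0
  have key := finrank_baseChange_eq_of_quasiInverse ℚ_[p] F G (n : ℤ_[p]) hunit hFG hGF
  change Module.finrank ℚ_[p] (ℚ_[p] ⊗[ℤ_[p]] D.X) = Module.finrank ℚ_[p] (ℚ_[p] ⊗[ℤ_[p]] D'.X)
  exact key

/-- The same for the packaged invariant `SelmerDualData.lambda`. [cite: GreenbergVatsal2000, §2 p. 28] -/
theorem lambda_eq_of_isogeny (φ : Isogeny W W') (D : W.SelmerDualData κ γ)
    (D' : W'.SelmerDualData κ γ) : D.lambda = D'.lambda :=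
  lambdaInvariant_eq_of_isogeny φ D D'

/-- `IsIsogenous` form. [cite: GreenbergVatsal2000, §2 p. 28] -/
theorem lambdaInvariant_eq_of_isIsogenous (h : IsIsogenous W W') (D : W.SelmerDualData κ γ)
    (D' : W'.SelmerDualData κ γ) : lambdaInvariant p D.X = lambdaInvariant p D'.X :=
  h.elim fun φ ↦ lambdaInvariant_eq_of_isogeny φ D D'

end Isogeny

end Summit.BirchSwinnertonDyer.Rank1Residual.X2.IsogenyLambdaInvariant

end
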